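import Summits.BirchSwinnertonDyer.BirchSwinnertonDyer.Theorems.GenusKolyvaginAtTwoPowDvdShaCardAtTwoRTUnramifiedParametrization
import Literature.NumberTheory.GaloisRepresentations.LocalHOneInertiaRestrictionProfinite
import Literature.NumberTheory.GaloisRepresentations.UnramifiedClassesInertia
import Literature.NumberTheory.GaloisRepresentations.HOneRestrictionOntoInvariantsFinite
import HarnessLib

/-!
# Route `GenusKolyvaginAtTwo`, crux U_T `ShaCardDvdPowAtTwoRT` (stmt-BirchSwinnertonDyer-23658; upper half
# `#Ш(E/K)[2^∞] ∣ 2^(2M₀)`) — THE UNRAMIFIED PARAMETRISATION WITH A NON-TRIVIAL FROBENIUS: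
# `H¹_ur(F, W) ≅ W/(φ − 1)W` as an explicit additive parametrisation `unr : W → H¹(F, W)` (kernel `(φ−1)W`, image `H¹_ur`)

Seat `bsd-line-gk2-p3` g25 (PROVER seat 3/3, cell `bsd-f1-sign2`), `--supports stmt-BirchSwinnertonDyer-23658` (helper; closes nothing).
THEOREMS ONLY (no definition, no named fact, no `sorry`).  BSD is NOT proved by any of this; neither is U_T nor any stub.

WHY (seat memo `Cruxes/ShaCardDvdPowAtTwoRT/Lines/norm-sharp-upper-gk2p3.md` §4/§10, stub «ℚ_ℓ cyclic local duality» of the twin-descent line).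
The tree's unramified parametrisation `exists_unramified_parametrization` (`…RTUnramifiedParametrization`, Howard Prop. 1.1.7) assumes the WHOLE
local Galois group acts trivially on `W` — true for `E[2^M]` over `K_λ` at a Kolyvagin prime, FALSE over `ℚ_ℓ`, where the Frobenius acts on
`E[2^M]` as complex conjugation (`FrobEqFrobInfty`).  This file removes the hypothesis: for a finite discrete module `W` on which only INERTIA acts
trivially and any arithmetic Frobenius lift `φ`, there is an additive `unr : W → H¹(F, W)` with image EXACTLY `H¹_ur(F, W)`, kernel EXACTLY
`(φ − 1)W`, and `unr w` represented by an `I_F`-vanishing cocycle with value `w` at `φ` — i.e. `H¹_ur(F, W) ≅ W/(φ−1)W` (Serre, Local Fields XIII §1;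
Rubin, Euler Systems, Lemma 1.3.2 / B.2), assembled from the tree's free-procyclic package (`exists_vanishing_apply_eq_of_isFreeProcyclic`,
`oneCocycleClass_eq(_zero)_iff_of_vanishing_absInertia`, `exists_contOneCocycles_apply_eq_of_finite`, `oneCocycleClass_mem_unramifiedSubgroup_iff_forall_eq_zero`).
With the regular frame (`…RTRegularFrameCoinvariants`: `E[2^M]/(τ−1)E[2^M] ≅ ℤ/2^M`) this makes `H¹_ur(ℚ_ℓ, E[2^M])` CYCLIC of order `2^M` at an
inert Kolyvagin prime — the first half of the cyclic local frame over `ℚ_ℓ` (no lost bit in McCallum's Lemma 5.3 over `ℚ`).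
* `exists_unramified_parametrization_of_inertia_trivial` — the parametrisation (image, kernel, representatives).

References: [SerreLocalFields1979] XIII §1 Prop. 1; [Rubin2000] Lemma 1.3.2, App. B §2; [Howard2004HeegnerKolyvagin] Prop. 1.1.7;
[McCallumLMS1991] §4 Prop. 4.4, §5 Lemma 5.3.
-/

set_option autoImplicit false

noncomputable section

open scoped Classical
open Function Field
open Literature.NumberTheory.GaloisRepresentations
open Literature.NumberTheory.GaloisRepresentations.DiscreteGaloisModule
open Literature.NumberTheory.GaloisRepresentations.IsNonarchimedeanLocalField
open Literature.NumberTheory.GaloisCohomology.Howard2004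
open Literature.GroupTheory (dense_zpowers_mk_topologicalClosure' exists_isOpen_index_topologicalClosure_zpowers)

-- the Theorems namespace of this sub repeats the summit name by design (D-0017 nested layout)
set_option linter.dupNamespace false

namespace Summit.BirchSwinnertonDyer.BirchSwinnertonDyer.Theorems.GenusExact.PlusDescent

section Generic

variable {F : Type} [Field F] [ValuativeRel F] [TopologicalSpace F] [IsNonarchimedeanLocalField F]
variable {W : Type} [AddCommGroup W] [TopologicalSpace W] [DiscreteTopology W] [Finite W]
  (ρ : DiscreteGaloisModule F W)

/-- **THE UNRAMIFIED PARAMETRISATION WITH A NON-TRIVIAL FROBENIUS.**  `F` a non-archimedean local field, `W` a finite discrete `Γ_F`-module on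
which the INERTIA group acts trivially, `φ` an arithmetic Frobenius lift.  There is an additive `unr : W → H¹(F, W)` such that: every `unr w` is
unramified; every unramified class is some `unr w`; **`unr w = 0 ⟺ w ∈ (φ − 1)W`**; and `unr w` is the class of an `I_F`-vanishing cocycle `z`
with `z(φ) = w`.  That is, `H¹_ur(F, W) ≅ W/(φ − 1)W` by evaluation at `φ`. [cite: SerreLocalFields1979, XIII §1 Prop. 1]
[cite: Rubin2000, Lemma 1.3.2 and App. B §2] [cite: Howard2004HeegnerKolyvagin, Prop. 1.1.7] -/
theorem exists_unramified_parametrization_of_inertia_trivial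
    (htrivI : ∀ τ ∈ absInertia F, ∀ w : W, ρ τ w = w) {φ : absoluteGaloisGroup F} (hφ : IsFrobPow φ 1) :
    ∃ unr : W →+ galoisCohomology ρ 1,
      (∀ w, unr w ∈ DiscreteGaloisModule.unramifiedSubgroup ρ 1) ∧
      (∀ c ∈ DiscreteGaloisModule.unramifiedSubgroup ρ 1, ∃ w, unr w = c) ∧
      (∀ w, unr w = 0 ↔ ∃ v : W, w = ρ φ v - v) ∧
      (∀ w, ∃ z : contOneCocycles ρ.toTopRep, (∀ n : absInertia F, z.1 n = 0) ∧ z.1 φ = w ∧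
        oneCocycleClass ρ.toTopRep z = unr w) := by
  haveI := absoluteGaloisGroup_compactSpace F
  haveI : (absInertia F).Normal := absInertia_normal_holds F
  have hN : IsClosed (absInertia F : Set (absoluteGaloisGroup F)) := isClosed_absInertia_holds F
  have hfree := isFreeProcyclic_quotient_absInertia' F
  have hdense := dense_zpowers_mk_absInertia_of_isFrobPow F hφ
  have hXc := ρ.continuous_smul
  -- for each `w`: an `I_F`-vanishing cocycle with value `w` at `φ`
  have hex : ∀ w : W, ∃ z : contOneCocycles ρ.toTopRep, (∀ n : absInertia F, z.1 n = 0) ∧ z.1 φ = w := by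
    intro w
    obtain ⟨z, hzI, hzφ⟩ := exists_vanishing_apply_eq_of_isFreeProcyclic ρ.toTopRep (absInertia F) hN hfree φ
      hdense (t := w) (fun n => by rw [ContinuousRep.toTopRep_ρ_apply]; exact htrivI n n.2 w)
      (exists_contOneCocycles_apply_eq_of_finite ρ _ (Subgroup.isClosed_topologicalClosure _)
        (dense_zpowers_mk_topologicalClosure' φ)
        (exists_isOpen_index_topologicalClosure_zpowers (absInertia F) hN hfree φ hdense) w)
    exact ⟨z, hzI, hzφ⟩
  choose z hzI hzφ using hex
  -- two vanishing cocycles with the same value at `φ` have the same class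
  have hcls : ∀ (y y' : contOneCocycles ρ.toTopRep), (∀ n : absInertia F, y.1 n = 0) → (∀ n : absInertia F, y'.1 n = 0) →
      y.1 φ = y'.1 φ → oneCocycleClass ρ.toTopRep y = oneCocycleClass ρ.toTopRep y' := by
    intro y y' hy hy' h
    exact (oneCocycleClass_eq_iff_of_vanishing_absInertia F ρ.toTopRep hXc hφ y y' hy hy').mpr
      ⟨0, fun _ => map_zero _, by rw [h, sub_self, map_zero, sub_zero]⟩
  let unr : W →+ galoisCohomology ρ 1 :=
    { toFun := fun w => oneCocycleClass ρ.toTopRep (z w)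
      map_zero' := by
        have h := hcls (z 0) 0 (hzI 0) (fun _ => rfl) (by rw [hzφ]; rfl)
        exact h.trans (oneCocycleClass_zero _)
      map_add' := fun w w' => by
        have h := hcls (z (w + w')) (z w + z w') (hzI _) (fun n => by
          change (z w).1 n + (z w').1 n = 0
          rw [hzI, hzI, add_zero]) (by
          change (z (w + w')).1 φ = (z w).1 φ + (z w').1 φ
          rw [hzφ, hzφ, hzφ])
        exact h.trans (oneCocycleClass_add _ _ _) }
  have hunr : ∀ w, unr w = oneCocycleClass ρ.toTopRep (z w) := fun w => rfl
  refine ⟨unr, fun w => ?_, fun c hc => ?_, fun w => ?_, fun w => ⟨z w, hzI w, hzφ w, (hunr w).symm⟩⟩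
  · rw [hunr]
    exact (oneCocycleClass_mem_unramifiedSubgroup_iff_forall_eq_zero ρ htrivI (z w)).mpr fun τ hτ => hzI w ⟨τ, hτ⟩
  · obtain ⟨y, rfl⟩ := oneCocycleClass_surjective ρ.toTopRep c
    have hy : ∀ n : absInertia F, y.1 n = 0 := fun n =>
      (oneCocycleClass_mem_unramifiedSubgroup_iff_forall_eq_zero ρ htrivI y).mp hc n n.2
    exact ⟨y.1 φ, by rw [hunr]; exact hcls _ _ (hzI _) hy (hzφ _)⟩
  · have key := oneCocycleClass_eq_zero_iff_of_vanishing_absInertia F ρ.toTopRep hXc hφ (z w) (hzI w)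
    constructor
    · intro h0
      obtain ⟨v, -, hv⟩ := key.mp h0
      refine ⟨v, ?_⟩
      rw [hzφ, ContinuousRep.toTopRep_ρ_apply] at hv
      exact hv
    · rintro ⟨v, hv⟩
      exact key.mpr ⟨v, fun n => by rw [ContinuousRep.toTopRep_ρ_apply]; exact htrivI n n.2 v,
        by rw [hzφ, ContinuousRep.toTopRep_ρ_apply]; exact hv⟩

end Generic

end Summit.BirchSwinnertonDyer.BirchSwinnertonDyer.Theorems.GenusExact.PlusDescent

end
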